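import Summits.Parity.GeneralizedHardyLittlewood.Theses.ZDegreeToeplitzBand
import Literature.NumberTheory.LFunctions.Zhang2022.KnifeEdgeLenZDegreeK0Short

/-! SKELETON for the REPAIRED K0 = stmt-Parity-20459 `InClassSideTablesPiece` (route `ZDegreeToeplitzBand`, rev 8),
prover ls-knife-K0-p1 g0 (line «sjrows»). Statements only; sorries ONLY inside `stub_*`; the single theorem
`InClassSideTablesPiece_of` concludes the crux BY NAME from the stubs and the LANDED reduction
`KnifeEdge.inClassMeanShort_of_sjRows` (p537807: Prop 7.1 + Lemma 8.1 + Prop 2.2(i) + Lemma 2.3 discharged; (S) ⇒ (M),(E);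
Apoly = profPoly for short pieces).
STUB 1 `stub_sjRows` = the §8 number theory for PROFILE data (LEMMA A = Lemma 8.2 generalised on the ψ-side via superposition of
`Lemma82.sum_twist_log_sub_main_le`; LEMMA A* = Lemmas 8.3/8.4 generalised on the anti-side; gathering by (8.10) `eq810_holds` +
the generic range-sum engine `Section8RangeEngine.weighted_sum_integral_eval`) — rows (S) `KnifeEdge.SjProfileRow c′ j u u′`,
j = 1,2,3, for every SHORT in-class piece (u = 0 on [θ,∞), θ < 1: the (7.2)-clean class).
STUB 2 `stub_sliver` = the WALL SLIVER (PT⁻², P]: from short pieces to all in-class pieces (formula I beyond the tree's (7.2)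
support `Nsupp = ⌈PT⁻²⌉`; pub-zhang STRUCTURE §6 / M-RULEBOOK LEMMA C: k ≥ 1 atoms at the wall are o(1)).
The programme SEARCHES and TYPES; no claim about Landau–Siegel zeros, Theorems 1–2 of arXiv:2211.02515 or a repaired
Margin232 until a kernel theorem says so. -/

namespace Summit.Parity.GeneralizedHardyLittlewood.Theses.ZDegreeToeplitzBand

open Literature.NumberTheory.LFunctions.Zhang2022

/-- stub 1 · ROWS (S) ON SHORT IN-CLASS PIECES (the §8 number theory of K0): for all large `c′`, every in-class piece `u`
vanishing from some `θ < 1` on satisfies `α⁻¹S_j(𝐚_u, conj 𝐚_u) = 𝔪_j(u)·𝔞 + o(𝔞)` under (A), `j = 1,2,3`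
(`KnifeEdge.SjProfileRow`, p537807; 𝔪_j = DISPLAY #5's −(1/π)∫𝔧_j𝔪_j). HARDEST. -/
theorem stub_sjRows :
    ∃ c₀ : ℝ, ∀ c' : ℝ, c₀ ≤ c' → ∀ (u u' : ℝ → ℂ) (θ : ℝ), KnifeEdge.InClassPiece u u' → θ < 1 →
      (∀ y : ℝ, θ ≤ y → u y = 0) →
      KnifeEdge.SjProfileRow c' 1 u u' ∧ KnifeEdge.SjProfileRow c' 2 u u' ∧ KnifeEdge.SjProfileRow c' 3 u u' := by
  sorry

/-- stub 2 · THE WALL SLIVER: for all large `c′`, the side table on SHORT in-class pieces gives it on ALL in-class pieces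
(the block `⌈PT⁻²⌉ ≤ n ≤ P` of a full-length piece, where `|u(z_n)| ≤ ‖u′‖₂·(2𝓛^{-7.9})^{1/2}` since `u(1) = 0`, has
discrete mean `o(𝔞𝔓)`: formula I on the sliver, outside the tree's Prop 7.1 support). -/
theorem stub_sliver :
    ∃ c₀ : ℝ, ∀ c' : ℝ, c₀ ≤ c' → KnifeEdge.InClassMeanShort c' → KnifeEdge.InClassMeanPiece c' := by
  sorry

/-- **`InClassSideTablesPiece_of : InClassSideTablesPiece`** — the repaired K0 from the two stubs BY NAME and the landed
reduction `KnifeEdge.inClassMeanShort_of_sjRows` (thresholds maxed); the ONLY theorem of the file that concludes the crux. -/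
theorem InClassSideTablesPiece_of : InClassSideTablesPiece := by
  obtain ⟨c₁, -, h₁⟩ := KnifeEdge.inClassMeanShort_of_sjRows
  obtain ⟨c₂, h₂⟩ := stub_sjRows
  obtain ⟨c₃, h₃⟩ := stub_sliver
  refine ⟨max c₁ (max c₂ c₃), fun c' hc' => ?_⟩
  have hc1 : c₁ ≤ c' := le_trans (le_max_left _ _) hc'
  have hc2 : c₂ ≤ c' := le_trans (le_trans (le_max_left _ _) (le_max_right _ _)) hc'
  have hc3 : c₃ ≤ c' := le_trans (le_trans (le_max_right _ _) (le_max_right _ _)) hc'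
  exact h₃ c' hc3 (h₁ c' hc1 (h₂ c' hc2))

end Summit.Parity.GeneralizedHardyLittlewood.Theses.ZDegreeToeplitzBand
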